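import Literature.AnabelianGeometry.Anabelioids.Induction
import Literature.AnabelianGeometry.AbsoluteAnabelian.DiagramMorphisms
import Mathlib.Topology.Algebra.ClopenNhdofOne
import HarnessLib

/-!
# Full subcategories of `B(G)` containing the coset objects are id-rigid when `Z(G) = 1` (e.g. the connected objects)

Topic `Literature/AnabelianGeometry/Anabelioids` (the Galois category `B(G)` of finite continuous
`G`-sets, [SemiAnbd] §0). S. Mochizuki, *Semi-graphs of anabelioids*, §0 p. 6: «`B(G)` is slim iff
`Z_G(H) = {1}` for every open `H`»; *Topics in Absolute Anabelian Geometry III*, §0 p. 27 (id-rigid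
categories) and Prop 4.2 (i) p. 106 l. 11–19, where id-rigidity is needed for «the full subcategory
… consisting of objects that map to `X`» — a full subcategory of CONNECTED objects. The tree has the
centre criterion for the WHOLE category, `isIdRigid_bCat_of_center_eq_bot` /
`isIdRigid_bCat_iff_center_eq_bot` (abc-iut-w6-d025, `AbsTopIII/AutHolLogFrobeniusGaloisCenterFree`);
an automorphism of the identity of a full SUBcategory is a priori less constrained, so the
subcategory statement is not a formal consequence. This file re-runs the compactness argument of
[SemiAnbd] §0 inside an arbitrary full subcategory:

* `isIdRigid_fullSubcategory_bCat_of_center_eq_bot` — for a profinite group `G` with `Z(G) = 1` and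
  ANY object property `P` of `B(G)` holding at the coset objects `G ⧸ K` (`K` open normal;
  `Induction.quotObj`), the full subcategory `P.FullSubcategory` is id-rigid. Proof (as in the tree's
  whole-category version): an automorphism `α` of `𝟭` moves the base coset of `G/K` to `n_K K`;
  naturality along the projections `G/K' → G/K` makes the closed cosets `n_K K` a directed family, so
  by compactness some `n` lies in all of them; naturality along right multiplications gives
  `[n, x] ∈ K` for all `K`, so `n ∈ Z(G) = 1`; finally every point of every object of the subcategory
  is the image of a base coset under an orbit map `G/K → U`, which lies in the subcategory because
  it is FULL;
* `isIdRigid_connected_bCat_of_center_eq_bot` — the case of the CONNECTED objects (nonempty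
  transitive finite continuous `G`-sets, property written inline), the shape of [AbsTopIII]
  Prop 4.2 (i).

Everything is proved; no definitions, no instances, no named facts. Refereed pre-IUT material; nothing here
bears on [IUTchIII] Cor. 3.12.

## References

* S. Mochizuki, *Semi-graphs of anabelioids*, Publ. RIMS 42 (2006), §0 p. 6. [MochizukiSemiAnbd2006]
* S. Mochizuki, *Topics in Absolute Anabelian Geometry III*, §0 p. 27, Prop. 4.2 (i) p. 106.
  [MochizukiAbsTopIII2015]
-/

noncomputable section

namespace Literature.AnabelianGeometry.Anabelioids

open _root_.CategoryTheory
open Literature.AlgebraicGeometry.Frobenioids (BCat)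
open Literature.AnabelianGeometry.AbsoluteAnabelian (IsIdRigid)
open scoped FintypeCatDiscrete Pointwise

universe u

variable {G : Type u} [Group G] [TopologicalSpace G] [IsTopologicalGroup G]

/-- The coset object `G ⧸ U` of an open subgroup of finite index is CONNECTED: its underlying
finite `G`-set is nonempty and transitive (the connected objects of the Galois category `B(G)` are
exactly the coset objects `G/H`, `H` open; we use «nonempty ∧ transitive» inline as the object
property, no definition). [cite: MochizukiSemiAnbd2006, Section 0 p.6] -/
theorem nonempty_and_isPretransitive_quotObj (U : Subgroup G) [Finite (G ⧸ U)]
    (hU : IsOpen (U : Set G)) :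
    Nonempty (Induction.quotObj U hU).obj.V ∧ MulAction.IsPretransitive G (Induction.quotObj U hU).obj.V := by
  refine ⟨⟨((1 : G) : G ⧸ U)⟩, ⟨fun q q' => ?_⟩⟩
  obtain ⟨g, rfl⟩ := QuotientGroup.mk_surjective (q : G ⧸ U)
  obtain ⟨g', rfl⟩ := QuotientGroup.mk_surjective (q' : G ⧸ U)
  refine ⟨g' * g⁻¹, ?_⟩
  change ((g' * g⁻¹) • (g : G ⧸ U) : G ⧸ U) = (g' : G ⧸ U)
  rw [MulAction.Quotient.smul_coe, smul_eq_mul, inv_mul_cancel_right]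

variable [CompactSpace G] [TotallyDisconnectedSpace G]

/-- **A full subcategory of `B(G)` containing the coset objects `G/K` (`K` open normal) is id-rigid
when `G` is a centre-free profinite group** — the compactness argument of [SemiAnbd] §0 («`B(G)`
slim iff `G` slim») run for the identity functor of the SUBcategory: the coset objects detect a
compatible family of cosets `n_K K`, compactness produces `n ∈ ⋂ n_K K`, naturality along right
translations makes `n` central, hence trivial, and orbit maps `G/K → U` (in the subcategory, which is
full) finish. [cite: MochizukiSemiAnbd2006, Section 0 p.6]
[cite: MochizukiAbsTopIII2015, Section 0 p.27] -/
theorem isIdRigid_fullSubcategory_bCat_of_center_eq_bot (hZ : Subgroup.center G = ⊥)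
    (P : ObjectProperty (BCat G))
    (hP : ∀ (K : OpenNormalSubgroup G) [Finite (G ⧸ K.toSubgroup)],
      P (Induction.quotObj K.toSubgroup K.isOpen')) :
    IsIdRigid P.FullSubcategory := by
  classical
  intro α
  haveI hfin : ∀ K : OpenNormalSubgroup G, Finite (G ⧸ K.toSubgroup) :=
    fun K => Subgroup.quotient_finite_of_isOpen K.toSubgroup K.isOpen'
  -- the coset objects `G/K`, inside the subcategory
  let QV : OpenNormalSubgroup G → P.FullSubcategory := fun K =>
    ⟨Induction.quotObj K.toSubgroup K.isOpen', hP K⟩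
  -- the action of `α` on the cosets
  let ev : ∀ K : OpenNormalSubgroup G, G ⧸ K.toSubgroup → G ⧸ K.toSubgroup :=
    fun K q => (α.hom.app (QV K)).hom.hom.hom q
  have ev_smul : ∀ K (x : G) (q : G ⧸ K.toSubgroup), ev K (x • q) = x • ev K q :=
    fun K x q => Induction.hom_smul (α.hom.app (QV K)).hom.hom x q
  -- naturality of `α`, pointwise
  have nat : ∀ {X Y : P.FullSubcategory} (k : X ⟶ Y) (v : X.obj.obj.V),
      (α.hom.app Y).hom.hom.hom (k.hom.hom.hom v) = k.hom.hom.hom ((α.hom.app X).hom.hom.hom v) :=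
    fun {X Y} k v => by
      have h := congrArg
        (fun φ : (𝟭 P.FullSubcategory).obj X ⟶ (𝟭 P.FullSubcategory).obj Y => φ.hom.hom.hom v)
        (α.hom.naturality k)
      exact h
  -- (1) monotonicity: naturality along the projection `G/K' → G/K`
  have mono : ∀ (K K' : OpenNormalSubgroup G) (hle : K'.toSubgroup ≤ K.toSubgroup) (n : G),
      ev K' ((1 : G) : G ⧸ K'.toSubgroup) = (n : G ⧸ K'.toSubgroup) →
      ev K ((1 : G) : G ⧸ K.toSubgroup) = (n : G ⧸ K.toSubgroup) := by
    intro K K' hle n hn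
    let p : QV K' ⟶ QV K := ObjectProperty.homMk (ObjectProperty.homMk
      { hom := FintypeCat.homMk fun q : G ⧸ K'.toSubgroup =>
          Quotient.map' id (fun g g' h => by
            have h' : g⁻¹ * g' ∈ K'.toSubgroup := QuotientGroup.leftRel_apply.mp h
            exact QuotientGroup.leftRel_apply.mpr (hle h')) q
        comm := fun x => by
          apply FintypeCat.hom_ext
          intro q
          obtain ⟨g, rfl⟩ := QuotientGroup.mk_surjective (q : G ⧸ K'.toSubgroup)
          simp only [FintypeCat.comp_apply, FintypeCat.homMk_apply]
          change Quotient.map' id _ (x • (g : G ⧸ K'.toSubgroup)) =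
            (x • (g : G ⧸ K.toSubgroup) : G ⧸ K.toSubgroup)
          rw [MulAction.Quotient.smul_coe, smul_eq_mul, MulAction.Quotient.smul_coe, smul_eq_mul]
          rfl })
    have h := nat p ((1 : G) : G ⧸ K'.toSubgroup)
    have hn₁ : (α.hom.app (QV K')).hom.hom.hom ((1 : G) : G ⧸ K'.toSubgroup) =
        (n : G ⧸ K'.toSubgroup) := hn
    rw [hn₁] at h
    exact h
  -- (2) naturality along right multiplication by an arbitrary `x ∈ G` (`K` is normal)
  have conj : ∀ (K : OpenNormalSubgroup G) (x : G) (n : G),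
      ev K ((1 : G) : G ⧸ K.toSubgroup) = (n : G ⧸ K.toSubgroup) →
      ev K (x : G ⧸ K.toSubgroup) = ((n * x : G) : G ⧸ K.toSubgroup) := by
    intro K x n hn
    let r : QV K ⟶ QV K := ObjectProperty.homMk (ObjectProperty.homMk
      { hom := FintypeCat.homMk fun q : G ⧸ K.toSubgroup =>
          Quotient.map' (fun g : G => g * x) (fun g g' h => by
            have h' : g⁻¹ * g' ∈ K.toSubgroup := QuotientGroup.leftRel_apply.mp h
            apply QuotientGroup.leftRel_apply.mpr
            have : (g * x)⁻¹ * (g' * x) = x⁻¹ * (g⁻¹ * g') * x := by group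
            rw [this]
            exact K.isNormal'.conj_mem' _ h' x) q
        comm := fun y => by
          apply FintypeCat.hom_ext
          intro q
          obtain ⟨g, rfl⟩ := QuotientGroup.mk_surjective (q : G ⧸ K.toSubgroup)
          simp only [FintypeCat.comp_apply, FintypeCat.homMk_apply]
          change Quotient.map' _ _ (y • (g : G ⧸ K.toSubgroup)) =
            (y • ((g * x : G) : G ⧸ K.toSubgroup) : G ⧸ K.toSubgroup)
          rw [MulAction.Quotient.smul_coe, smul_eq_mul, MulAction.Quotient.smul_coe, smul_eq_mul]
          change (((y * g) * x : G) : G ⧸ K.toSubgroup) = ((y * (g * x) : G) : G ⧸ K.toSubgroup)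
          rw [mul_assoc] })
    have h := nat r ((1 : G) : G ⧸ K.toSubgroup)
    have hn₁ : (α.hom.app (QV K)).hom.hom.hom ((1 : G) : G ⧸ K.toSubgroup) =
        (n : G ⧸ K.toSubgroup) := hn
    rw [hn₁] at h
    have h' : ev K (((1 : G) * x : G) : G ⧸ K.toSubgroup) = ((n * x : G) : G ⧸ K.toSubgroup) := h
    rw [one_mul] at h'
    exact h'
  -- (3) the key step: `α` fixes the base coset of every `G/K`
  have key : ∀ K : OpenNormalSubgroup G,
      ev K ((1 : G) : G ⧸ K.toSubgroup) = ((1 : G) : G ⧸ K.toSubgroup) := by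
    obtain ⟨K₀, -⟩ := ProfiniteGrp.exist_openNormalSubgroup_sub_open_nhds_of_one
      (isOpen_univ (X := G)) (Set.mem_univ (1 : G))
    haveI : Nonempty (OpenNormalSubgroup G) := ⟨K₀⟩
    let N : OpenNormalSubgroup G → Set G := fun K =>
      {n : G | ev K ((1 : G) : G ⧸ K.toSubgroup) = (n : G ⧸ K.toSubgroup)}
    have hNne : ∀ K, (N K).Nonempty := fun K => by
      obtain ⟨n, hn⟩ := QuotientGroup.mk_surjective (ev K ((1 : G) : G ⧸ K.toSubgroup))
      exact ⟨n, hn.symm⟩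
    have hNclosed : ∀ K, IsClosed (N K) := fun K => by
      obtain ⟨n₀, hn₀⟩ := hNne K
      have : N K = (fun n : G => n₀⁻¹ * n) ⁻¹' (K : Set G) := by
        ext n
        simp only [Set.mem_setOf_eq, Set.mem_preimage, N, SetLike.mem_coe]
        rw [hn₀, QuotientGroup.eq]
        rfl
      rw [this]
      exact K.toOpenSubgroup.isClosed.preimage (by fun_prop)
    have hinf : ∀ (K K' : OpenNormalSubgroup G) (g : G), g ∈ (K ⊓ K').toSubgroup →
        g ∈ K.toSubgroup ∧ g ∈ K'.toSubgroup := fun K K' g hg => Subgroup.mem_inf.mp hg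
    have hdir : Directed (· ⊇ ·) N := fun K K' => by
      refine ⟨K ⊓ K', ?_, ?_⟩
      · intro n hn
        exact mono K (K ⊓ K') (fun g hg => (hinf _ _ g hg).1) n hn
      · intro n hn
        exact mono K' (K ⊓ K') (fun g hg => (hinf _ _ g hg).2) n hn
    obtain ⟨n, hn⟩ := IsCompact.nonempty_iInter_of_directed_nonempty_isCompact_isClosed N hdir
      hNne (fun K => (hNclosed K).isCompact) hNclosed
    have hn' : ∀ K : OpenNormalSubgroup G, n ∈ N K := fun K => Set.mem_iInter.mp hn K
    -- `n` commutes with every `x` modulo every `K`, hence on the nose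
    have hcomm : ∀ x : G, x * n = n * x := by
      intro x
      have hmem : ∀ K : OpenNormalSubgroup G, (n * x)⁻¹ * (x * n) ∈ K.toSubgroup := fun K => by
        have h1 : ev K (x : G ⧸ K.toSubgroup) = ((n * x : G) : G ⧸ K.toSubgroup) :=
          conj K x n (hn' K)
        have h2 : ev K (x : G ⧸ K.toSubgroup) = ((x * n : G) : G ⧸ K.toSubgroup) := by
          have := ev_smul K x ((1 : G) : G ⧸ K.toSubgroup)
          rw [MulAction.Quotient.smul_coe, smul_eq_mul, mul_one, hn' K,
            MulAction.Quotient.smul_coe, smul_eq_mul] at this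
          exact this
        rw [h2] at h1
        exact QuotientGroup.eq.mp h1.symm
      by_contra hne
      have hne' : (n * x)⁻¹ * (x * n) ≠ 1 := by
        intro h
        apply hne
        rw [inv_mul_eq_one] at h
        exact h.symm
      obtain ⟨K₁, hK₁⟩ := ProfiniteGrp.exist_openNormalSubgroup_sub_open_nhds_of_one
        (isOpen_compl_singleton (x := (n * x)⁻¹ * (x * n)))
        (show (1 : G) ∈ ({(n * x)⁻¹ * (x * n)}ᶜ : Set G) from fun h => hne' h.symm)
      exact hK₁ (hmem K₁) rfl
    have hn1 : n = 1 := by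
      have hz : n ∈ Subgroup.center G := Subgroup.mem_center_iff.mpr hcomm
      rw [hZ] at hz
      exact hz
    intro K
    have := hn' K
    rw [hn1] at this
    exact this
  -- (4) conclusion: `α` is the identity on every point of every object of the subcategory
  apply Iso.ext
  apply NatTrans.ext
  funext U
  rw [Iso.refl_hom, NatTrans.id_app]
  apply ObjectProperty.hom_ext
  apply ObjectProperty.hom_ext
  apply Action.hom_ext
  apply FintypeCat.hom_ext
  intro b
  change (α.hom.app U).hom.hom.hom b = b
  have hb : IsOpen (MulAction.stabilizer G b : Set G) :=
    (Induction.isContinuous_iff U.obj.obj).mp U.obj.property b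
  obtain ⟨K, hK⟩ := ProfiniteGrp.exist_openNormalSubgroup_sub_open_nhds_of_one hb
    (MulAction.stabilizer G b).one_mem
  have hKb : K.toSubgroup ≤ MulAction.stabilizer G b := fun g hg => hK hg
  -- the orbit map `G/K → U`, `gK ↦ g • b` — a morphism of the FULL subcategory
  let φ : QV K ⟶ U := ObjectProperty.homMk (ObjectProperty.homMk
    { hom := FintypeCat.homMk fun q : G ⧸ K.toSubgroup =>
        Quotient.liftOn' q (fun g : G => g • b) fun g g' h => by
          have h' : g⁻¹ * g' ∈ K.toSubgroup := QuotientGroup.leftRel_apply.mp h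
          have := hKb h'
          rw [MulAction.mem_stabilizer_iff, mul_smul, inv_smul_eq_iff] at this
          exact this.symm
      comm := fun x => by
        apply FintypeCat.hom_ext
        intro q
        obtain ⟨g, rfl⟩ := QuotientGroup.mk_surjective (q : G ⧸ K.toSubgroup)
        simp only [FintypeCat.comp_apply, FintypeCat.homMk_apply]
        change Quotient.liftOn' (x • (g : G ⧸ K.toSubgroup) : G ⧸ K.toSubgroup) _ _ =
          x • (g • b)
        rw [MulAction.Quotient.smul_coe, smul_eq_mul]
        exact mul_smul x g b })
  have h := nat φ ((1 : G) : G ⧸ K.toSubgroup)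
  change (α.hom.app U).hom.hom.hom ((1 : G) • b) = Quotient.liftOn' (ev K _) _ _ at h
  rw [key K, one_smul] at h
  rw [h]
  exact one_smul G b

/-- **The full subcategory of CONNECTED objects of `B(G)` is id-rigid when the profinite group `G`
is centre-free** — the shape in which [AbsTopIII] Prop. 4.2 (i) uses id-rigidity («the full
subcategory of `EA` consisting of objects that map to `X`», a category of connected finite étale
coverings), with Lemma 4.3's slimness weakened to `Z(G) = 1`.
[cite: MochizukiAbsTopIII2015, Proposition 4.2 (i) p.106] [cite: MochizukiSemiAnbd2006, Section 0 p.6] -/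
theorem isIdRigid_connected_bCat_of_center_eq_bot (hZ : Subgroup.center G = ⊥) :
    IsIdRigid (ObjectProperty.FullSubcategory
      fun X : BCat G => Nonempty X.obj.V ∧ MulAction.IsPretransitive G X.obj.V) :=
  isIdRigid_fullSubcategory_bCat_of_center_eq_bot hZ _
    fun K _ => nonempty_and_isPretransitive_quotObj K.toSubgroup K.isOpen'

end Literature.AnabelianGeometry.Anabelioids
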